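import Summits.CriticalPhenomena.PercolationContinuityZ3.Theorems.PercNearOneGluingNoHeavyLowerTailKnQuestion8CoefficientwiseRootSetKernelRowTwoPrep
import HarnessLib

/-!
# The root-set kernel, row 2 of RCSET — the combinatorial core (one inner colouring, abstract cluster maps) — prim-lf-2 gen 59

Support file (`--supports stmt-CriticalPhenomena-4575`, closed), prover `prim-lf-2` (gen 59).  No definitions, no named facts, no sorries; standard axioms.
Memo `prim-lf-2/CW-KERNEL-gen59.md` §2; companions `…RootSetKernelRowTwoPrep.lean` (box bounds), `…RootSetKernelRowTwo.lean` (the theorem `rcset_row_two`, which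
instantiates this core with the red cluster of `S`, the red cluster of `U` and the blue cluster of `U` on the colourings `τ ∪ ω` of a fixed inner colouring `τ`).

THE CORE.  Three pairwise disjoint nonempty finsets of "outer edges" `Aq` (`U–q`), `By` (`U–y`), `Cq` (`q–y`), `Out = Aq ∪ By ∪ Cq`; a finset of vertices `U` with
`V = U ⊔ {q, y}`; monotone `f, g`; and three maps `R, P, B : Finset ι → Set V` (think: red cluster of `S ⊆ U`, red cluster of `U`, blue cluster of `U`, as functions of
the set `ω ⊆ Out` of red outer edges) subject to the axioms (all read off from connectivity in `…RowTwo.lean`): `U ⊆ P ω`, `U ⊆ B ω`; `R` monotone; `R (ω ∩ Cq) ⊆ U`;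
`B ω ⊆ U` if `Aq ∪ By ⊆ ω`; `y ∉ R α` for `α ⊆ Aq`; `y ∉ B ω` if `By ∪ Cq ⊆ ω`; a blue `By` edge puts `y ∈ B ω`, a blue `Aq` edge puts `q ∈ B ω`, `y ∈ B ω` and a blue
`Cq` edge put `q ∈ B ω` (and symmetrically), the red analogues for `P`, and `q ∈ R ω` with a red `Cq` edge puts `y ∈ R ω`.
* `Coefficientwise.rcset_row_two_core` — under these axioms, with `T_P(ω) = (f Pω − f Bω)(g Pω − g Bω)`, `T_R(ω) = (f Rω − f Bω)(g Rω − g Bω)`: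
  `Σ_{ω ⊆ Out, y ∉ Bω} T_P(ω) ≤ Σ_{ω ⊆ Out, ¬(y ∈ Rω ∧ y ∈ Bω)} T_R(ω)`.
Proof.  DEFICIT set `D = {ω : y ∉ B ω}`: `ω ∈ D` forces `By ⊆ ω` and (`Aq ⊆ ω` or `Cq ⊆ ω`), and `P ω = V`.  PARTNER `ψ ω = ω ∩ Cq` (if `Aq ⊆ ω`), `= ω ∩ Aq`
(if `∅ ≠ ω ∩ Aq ≠ Aq`), `= Aq` (if `ω ∩ Aq = ∅`): injective on `D`, lands outside `D`, admissible; outside `D` every admissible `T_R` is `≥ 0` (uses `Cq ≠ ∅`).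
Termwise `T_P(ω) ≤ T_R(ω) + T_R(ψ ω) + tr(ω)` (`skew_box_bound`, `split_box_bound`) with a transfer `tr = ∓(f A₁ − f c₁)(g A₁ − g c₁)` between `ω = Out` and
`ω = By ∪ Cq` (`A₁ = R Out`, `c₁ = R (Out ∩ Cq)`), `Σ_D tr = 0`.  Census behind RCSET row 2 (exact over ALL monotone pairs on co-independent normal forms, prim-lf-2 gen 59): 0 violations.
[cite: KozmaNitzan2024, Questions 8–9 (§5.5 p. 36) (context: the Question-8 pocket covariance programme)]
-/

namespace Summit.CriticalPhenomena.PercolationContinuityZ3.Theorems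

open Finset Literature.Probability.Percolation

namespace Coefficientwise

variable {ι V : Type*}

open Classical in
/-- **Row 2 of RCSET — combinatorial core** (see the module docstring for the axioms on `R, P, B`). [cite: KozmaNitzan2024, Questions 8–9 (§5.5 p. 36) (context)] -/
theorem rcset_row_two_core [DecidableEq ι] (Aq By Cq : Finset ι) (hAqBy : ∀ i, i ∈ Aq → i ∉ By) (hAqCq : ∀ i, i ∈ Aq → i ∉ Cq) (hByCq : ∀ i, i ∈ By → i ∉ Cq)
    (hAqne : Aq.Nonempty) (hByne : By.Nonempty) (hCqne : Cq.Nonempty)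
    (U : Finset V) (y q : V) (hyU : y ∉ U) (hUc : ∀ v : V, v ≠ q → v ≠ y → v ∈ U)
    (f g : Set V → ℝ) (hf : Monotone f) (hg : Monotone g) (R P B : Finset ι → Set V)
    (hUP : ∀ ω, (↑U : Set V) ⊆ P ω) (hUB : ∀ ω, (↑U : Set V) ⊆ B ω) (hRmono : ∀ ω ω' : Finset ι, ω ⊆ ω' → R ω ⊆ R ω')
    (hRC : ∀ ω : Finset ι, ω ⊆ Aq ∪ By ∪ Cq → R (ω ∩ Cq) ⊆ ↑U) (hBU : ∀ ω : Finset ι, Aq ⊆ ω → By ⊆ ω → B ω ⊆ ↑U)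
    (hyA : ∀ α : Finset ι, α ⊆ Aq → y ∉ R α) (hyBn : ∀ ω : Finset ι, By ⊆ ω → Cq ⊆ ω → y ∉ B ω)
    (hyB : ∀ ω : Finset ι, (∃ j ∈ By, j ∉ ω) → y ∈ B ω) (hqB : ∀ ω : Finset ι, (∃ i ∈ Aq, i ∉ ω) → q ∈ B ω)
    (hqB' : ∀ ω : Finset ι, y ∈ B ω → (∃ k ∈ Cq, k ∉ ω) → q ∈ B ω) (hyB' : ∀ ω : Finset ι, q ∈ B ω → (∃ k ∈ Cq, k ∉ ω) → y ∈ B ω)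
    (hyP : ∀ ω : Finset ι, (∃ j ∈ By, j ∈ ω) → y ∈ P ω) (hqP : ∀ ω : Finset ι, (∃ i ∈ Aq, i ∈ ω) → q ∈ P ω)
    (hqP' : ∀ ω : Finset ι, y ∈ P ω → (∃ k ∈ Cq, k ∈ ω) → q ∈ P ω) (hyR' : ∀ ω : Finset ι, q ∈ R ω → (∃ k ∈ Cq, k ∈ ω) → y ∈ R ω) :
    ∑ ω ∈ (Aq ∪ By ∪ Cq).powerset, (if y ∉ B ω then (f (P ω) - f (B ω)) * (g (P ω) - g (B ω)) else 0) ≤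
    ∑ ω ∈ (Aq ∪ By ∪ Cq).powerset, (if ¬ (y ∈ R ω ∧ y ∈ B ω) then (f (R ω) - f (B ω)) * (g (R ω) - g (B ω)) else 0) := by
  -- notation
  set Out : Finset ι := Aq ∪ By ∪ Cq with hOut
  set admS : Finset ι → Prop := fun ω => ¬ (y ∈ R ω ∧ y ∈ B ω) with hadmS
  set TU : Finset ι → ℝ := fun ω => (f (P ω) - f (B ω)) * (g (P ω) - g (B ω)) with hTU
  set TS : Finset ι → ℝ := fun ω => (f (R ω) - f (B ω)) * (g (R ω) - g (B ω)) with hTS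
  change ∑ ω ∈ Out.powerset, (if y ∉ B ω then TU ω else 0) ≤ ∑ ω ∈ Out.powerset, (if admS ω then TS ω else 0)
  have hAqOut : Aq ⊆ Out := fun i hi => Finset.mem_union_left _ (Finset.mem_union_left _ hi)
  have hByOut : By ⊆ Out := fun i hi => Finset.mem_union_left _ (Finset.mem_union_right _ hi)
  have hCqOut : Cq ⊆ Out := fun i hi => Finset.mem_union_right _ hi
  -- a set containing `U` and `q` contains every vertex but `y`; containing `q` and `y` too it is everything
  have fill_noty : ∀ X : Set V, (↑U : Set V) ⊆ X → q ∈ X → ∀ v, v ≠ y → v ∈ X := by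
    intro X hUX hqX v hvy
    by_cases hvq : v = q
    · exact hvq ▸ hqX
    · exact hUX (Finset.mem_coe.mpr (hUc v hvq hvy))
  have fill_univ : ∀ X : Set V, (↑U : Set V) ⊆ X → q ∈ X → y ∈ X → X = Set.univ := by
    intro X hUX hqX hyX
    refine Set.eq_univ_of_forall fun v => ?_
    by_cases hvy : v = y
    · exact hvy ▸ hyX
    · exact fill_noty X hUX hqX v hvy
  -- deficit structure: `y ∉ B_U(τ ∪ ω)` forces `By ⊆ ω` and (`Aq ⊆ ω` or `Cq ⊆ ω`)
  have D_By : ∀ ω : Finset ι, y ∉ B ω → By ⊆ ω := by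
    intro ω hy j hj; by_contra hjω; exact hy (hyB ω ⟨j, hj, hjω⟩)
  have D_AC : ∀ ω : Finset ι, y ∉ B ω → ¬ Aq ⊆ ω → Cq ⊆ ω := by
    intro ω hy hA k hk; by_contra hkω
    obtain ⟨i, hi, hiω⟩ := Finset.not_subset.mp hA
    exact hy (hyB' ω (hqB ω ⟨i, hi, hiω⟩) ⟨k, hk, hkω⟩)
  -- on deficit colourings `R_U(τ ∪ ω) = univ`
  have D_RU : ∀ ω : Finset ι, ω ⊆ Out → y ∉ B ω → P ω = Set.univ := by
    intro ω hω hy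
    obtain ⟨j, hj⟩ := hByne
    have hyR : y ∈ P ω := hyP ω ⟨j, hj, D_By ω hy hj⟩
    refine fill_univ _ (hUP ω) ?_ hyR
    by_cases hA : Aq ⊆ ω
    · obtain ⟨i, hi⟩ := hAqne; exact hqP ω ⟨i, hi, hA hi⟩
    · obtain ⟨k, hk⟩ := hCqne; exact hqP' ω hyR ⟨k, hk, D_AC ω hy hA hk⟩
  -- outside the deficit set every admissible `S`-term is `≥ 0` (uses `Cq ≠ ∅`)
  have rest_nonneg : ∀ ω ∈ Out.powerset, ¬ (y ∉ B ω) → 0 ≤ (if admS ω then TS ω else 0) := by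
    intro ω hω hyy
    have hω' := Finset.mem_powerset.mp hω
    have hy : y ∈ B ω := not_not.mp hyy
    split_ifs with hadm
    · have hyR : y ∉ R ω := fun h => hadm ⟨h, hy⟩
      simp only [hTS]
      by_cases hq : q ∈ B ω
      · have huniv : B ω = Set.univ := fill_univ _ (hUB ω) hq hy
        rw [huniv]
        exact mul_nonneg_of_nonpos_of_nonpos (sub_nonpos.mpr (hf (Set.subset_univ _))) (sub_nonpos.mpr (hg (Set.subset_univ _)))
      · -- all `q–y` edges are red, so `q ∉ R_S` (else `y ∈ R_S`), so `R_S ⊆ U ⊆ B_U`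
        have hCω : Cq ⊆ ω := by
          intro k hk; by_contra hkω; exact hq (hqB' ω hy ⟨k, hk, hkω⟩)
        have hqR : q ∉ R ω := by
          intro h; obtain ⟨k, hk⟩ := hCqne
          exact hyR (hyR' ω h ⟨k, hk, hCω hk⟩)
        have hsub : R ω ⊆ B ω := by
          intro v hv
          have hvq : v ≠ q := fun e => hqR (e ▸ hv)
          have hvy : v ≠ y := fun e => hyR (e ▸ hv)
          exact hUB ω (Finset.mem_coe.mpr (hUc v hvq hvy))
        exact mul_nonneg_of_nonpos_of_nonpos (sub_nonpos.mpr (hf hsub)) (sub_nonpos.mpr (hg hsub))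
    · exact le_refl _
  /- ### the deficit set, the partner map and the transfer -/
  set D : Finset (Finset ι) := Out.powerset.filter (fun ω => y ∉ B ω) with hD
  set ψ : Finset ι → Finset ι := fun ω => if Aq ⊆ ω then ω ∩ Cq else if ω ∩ Aq = ∅ then Aq else ω ∩ Aq with hψ
  set c₁ : Set V := R (Out ∩ Cq) with hc₁
  set A₁ : Set V := R Out with hA₁
  set X : ℝ := (f A₁ - f c₁) * (g A₁ - g c₁) with hX
  set tr : Finset ι → ℝ := fun ω => (if ω = Out then -X else 0) + (if ω = By ∪ Cq then X else 0) with htr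
  have memD : ∀ ω, ω ∈ D ↔ ω ⊆ Out ∧ y ∉ B ω := by
    intro ω; simp only [hD, Finset.mem_filter, Finset.mem_powerset]
  -- decomposition of a deficit colouring
  have D_shapeA : ∀ ω ∈ D, Aq ⊆ ω → ω = Aq ∪ By ∪ (ω ∩ Cq) := by
    intro ω hω hA
    obtain ⟨hωO, hy⟩ := (memD ω).mp hω
    ext i
    simp only [Finset.mem_union, Finset.mem_inter]
    constructor
    · intro hi
      rcases Finset.mem_union.mp (hωO hi) with h | h
      · rcases Finset.mem_union.mp h with h | h
        · exact Or.inl (Or.inl h)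
        · exact Or.inl (Or.inr h)
      · exact Or.inr ⟨hi, h⟩
    · rintro ((h | h) | ⟨h, _⟩)
      · exact hA h
      · exact D_By ω hy h
      · exact h
  have D_shapeB : ∀ ω ∈ D, ¬ Aq ⊆ ω → ω = (ω ∩ Aq) ∪ By ∪ Cq := by
    intro ω hω hA
    obtain ⟨hωO, hy⟩ := (memD ω).mp hω
    ext i
    simp only [Finset.mem_union, Finset.mem_inter]
    constructor
    · intro hi
      rcases Finset.mem_union.mp (hωO hi) with h | h
      · rcases Finset.mem_union.mp h with h | h
        · exact Or.inl (Or.inl ⟨hi, h⟩)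
        · exact Or.inl (Or.inr h)
      · exact Or.inr h
    · rintro ((⟨h, _⟩ | h) | h)
      · exact h
      · exact D_By ω hy h
      · exact D_AC ω hy hA h
  -- the two special deficit colourings
  have Out_in_D : Out ∈ D := by
    exact (memD Out).mpr ⟨subset_rfl, fun hy => hyU (Finset.mem_coe.mp (hBU Out hAqOut hByOut hy))⟩
  have BC_in_D : By ∪ Cq ∈ D := by
    exact (memD (By ∪ Cq)).mpr ⟨Finset.union_subset hByOut hCqOut, hyBn (By ∪ Cq) Finset.subset_union_left Finset.subset_union_right⟩
  have Out_ne_BC : Out ≠ By ∪ Cq := by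
    intro h; obtain ⟨i, hi⟩ := hAqne
    have : i ∈ By ∪ Cq := h ▸ hAqOut hi
    rcases Finset.mem_union.mp this with h' | h'
    · exact hAqBy i hi h'
    · exact hAqCq i hi h'
  have not_Aq_sub_BC : ¬ Aq ⊆ By ∪ Cq := by
    intro h; obtain ⟨i, hi⟩ := hAqne
    rcases Finset.mem_union.mp (h hi) with h' | h'
    · exact hAqBy i hi h'
    · exact hAqCq i hi h'
  have sum_tr : ∑ ω ∈ D, tr ω = 0 := by
    simp only [htr, Finset.sum_add_distrib, Finset.sum_ite_eq', if_pos Out_in_D, if_pos BC_in_D]; ring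
  /- ### the termwise bound `T_U ≤ T_S + T_S ∘ ψ + tr` on `D` -/
  have termwise : ∀ ω ∈ D, TU ω ≤ TS ω + TS (ψ ω) + tr ω := by
    intro ω hω
    obtain ⟨hωO, hy⟩ := (memD ω).mp hω
    have hByω : By ⊆ ω := D_By ω hy
    have hRUuniv : P ω = Set.univ := D_RU ω hωO hy
    have hUBω : (↑U : Set V) ⊆ B ω := hUB ω
    have hRSle : f (R ω) ≤ f Set.univ := hf (Set.subset_univ _)
    have hRSle' : g (R ω) ≤ g Set.univ := hg (Set.subset_univ _)
    -- `c₁ ⊆ U`, `c₁ ⊆ A₁`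
    have hc₁U : c₁ ⊆ ↑U := hRC Out subset_rfl
    have hc₁A₁ : c₁ ⊆ A₁ := hRmono _ _ Finset.inter_subset_left
    have hA₁le : f A₁ ≤ f Set.univ := hf (Set.subset_univ _)
    have hA₁le' : g A₁ ≤ g Set.univ := hg (Set.subset_univ _)
    simp only [hTU, hTS, hRUuniv]
    by_cases hA : Aq ⊆ ω
    · -- case A: partner `ω ∩ Cq`
      have hψω : ψ ω = ω ∩ Cq := by simp only [hψ, if_pos hA]
      rw [hψω]
      -- the partner's clusters
      have hR'B : R (ω ∩ Cq) ⊆ B ω := (hRC ω hωO).trans hUBω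
      have hR'A : R (ω ∩ Cq) ⊆ R ω := hRmono _ _ Finset.inter_subset_left
      have hB'univ : B (ω ∩ Cq) = Set.univ := by
        obtain ⟨i, hi⟩ := hAqne; obtain ⟨j, hj⟩ := hByne
        refine fill_univ _ (hUB _) (hqB _ ⟨i, hi, fun h => hAqCq i hi (Finset.mem_inter.mp h).2⟩)
          (hyB _ ⟨j, hj, fun h => hByCq j hj (Finset.mem_inter.mp h).2⟩)
      rw [hB'univ]
      by_cases hωOut : ω = Out
      · -- A1: `ω = Out`, transfer `-X`
        have htrω : tr ω = -X := by
          simp only [htr, if_pos hωOut, if_neg (hωOut ▸ Out_ne_BC : ω ≠ By ∪ Cq)]; ring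
        rw [htrω]
        have hωc : R (ω ∩ Cq) = c₁ := by rw [hc₁, hωOut]
        have hωA : R ω = A₁ := by rw [hA₁, hωOut]
        rw [hωc, hωA]
        have key := split_box_bound (fc := f c₁) (fI := f (B ω)) (fA := f A₁) (fV := f Set.univ)
          (gc := g c₁) (gI := g (B ω)) (gA := g A₁) (gV := g Set.univ)
          (hf (hc₁U.trans hUBω)) hA₁le (hg (hc₁U.trans hUBω)) hA₁le'
        simp only [hX]; nlinarith [key]
      · -- A2: plain skew box bound
        have hωBC : ω ≠ By ∪ Cq := fun h => not_Aq_sub_BC (h ▸ hA)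
        have htrω : tr ω = 0 := by simp only [htr, if_neg hωOut, if_neg hωBC]; ring
        rw [htrω]
        have key := skew_box_bound (fR := f (R (ω ∩ Cq))) (fA := f (R ω)) (fB := f (B ω)) (fP := f Set.univ)
          (gR := g (R (ω ∩ Cq))) (gA := g (R ω)) (gB := g (B ω)) (gP := g Set.univ)
          (hf hR'A) hRSle (hf hR'B) (hg hR'A) hRSle' (hg hR'B)
        nlinarith [key]
    · -- case B: `Cq ⊆ ω`, `By ⊆ ω`
      have hCω : Cq ⊆ ω := D_AC ω hy hA
      have hωOut : ω ≠ Out := fun h => hA (h ▸ hAqOut)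
      -- `q ∈ B_U(s)`: some `Aq` edge is blue
      have hqBω : q ∈ B ω := by
        obtain ⟨i, hi, hiω⟩ := Finset.not_subset.mp hA; exact hqB ω ⟨i, hi, hiω⟩
      have hnoty : ∀ v, v ≠ y → v ∈ B ω := fill_noty _ hUBω hqBω
      -- for `α ⊆ Aq`: `R α` misses `y`, hence lies in `B ω`
      have hRα : ∀ α : Finset ι, α ⊆ Aq → R α ⊆ B ω := by
        intro α hα v hv
        refine hnoty v fun hvy => ?_
        subst hvy
        exact hyA α hα hv
      by_cases hα0 : ω ∩ Aq = ∅
      · -- B1: `ω = By ∪ Cq`, partner `Aq`, transfer `+X`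
        have hψω : ψ ω = Aq := by simp only [hψ, if_neg hA, if_pos hα0]
        rw [hψω]
        have hωBC : ω = By ∪ Cq := by
          rw [D_shapeB ω hω hA, hα0, Finset.empty_union]
        have htrω : tr ω = X := by simp only [htr, if_neg hωOut, if_pos hωBC]; ring
        rw [htrω]
        have hB'univ : B Aq = Set.univ := by
          obtain ⟨j, hj⟩ := hByne; obtain ⟨k, hk⟩ := hCqne
          have hyb : y ∈ B Aq := hyB _ ⟨j, hj, fun h => hAqBy j h hj⟩
          exact fill_univ _ (hUB _) (hqB' _ hyb ⟨k, hk, fun h => hAqCq k h hk⟩) hyb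
        rw [hB'univ]
        -- `Q = R_S(τ ∪ Aq) ⊆ A₁`, `Q ⊆ B_U(s)`; `c₁ ⊆ R_S(s) ⊆ A₁`, `c₁ ⊆ B_U(s)`
        have hQA₁ : R Aq ⊆ A₁ := hRmono _ _ hAqOut
        have hQB : R Aq ⊆ B ω := hRα Aq subset_rfl
        have hc₁A₃ : c₁ ⊆ R ω := hRmono _ _ (fun i hi => hCω (Finset.mem_inter.mp hi).2)
        have hA₃A₁ : R ω ⊆ A₁ := hRmono _ _ hωO
        have key1 := skew_box_bound (fR := f (R Aq)) (fA := f A₁) (fB := f (B ω)) (fP := f Set.univ)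
          (gR := g (R Aq)) (gA := g A₁) (gB := g (B ω)) (gP := g Set.univ)
          (hf hQA₁) hA₁le (hf hQB) (hg hQA₁) hA₁le' (hg hQB)
        have key2 := skew_box_bound (fR := f c₁) (fA := f (R ω)) (fB := f (B ω)) (fP := f A₁)
          (gR := g c₁) (gA := g (R ω)) (gB := g (B ω)) (gP := g A₁)
          (hf hc₁A₃) (hf hA₃A₁) (hf (hc₁U.trans hUBω)) (hg hc₁A₃) (hg hA₃A₁) (hg (hc₁U.trans hUBω))
        simp only [hX]; nlinarith [key1, key2]
      · -- B2: partner `ω ∩ Aq` (nonempty, proper)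
        have hψω : ψ ω = ω ∩ Aq := by simp only [hψ, if_neg hA, if_neg hα0]
        rw [hψω]
        have hωBC : ω ≠ By ∪ Cq := by
          intro h; apply hα0
          rw [h]; ext i
          simp only [Finset.mem_inter, Finset.mem_union, Finset.notMem_empty, iff_false, not_and]
          rintro (h' | h') hiA
          · exact hAqBy i hiA h'
          · exact hAqCq i hiA h'
        have htrω : tr ω = 0 := by simp only [htr, if_neg hωOut, if_neg hωBC]; ring
        rw [htrω]
        have hB'univ : B (ω ∩ Aq) = Set.univ := by
          obtain ⟨i, hi, hiω⟩ := Finset.not_subset.mp hA; obtain ⟨j, hj⟩ := hByne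
          exact fill_univ _ (hUB _) (hqB _ ⟨i, hi, fun h => hiω (Finset.mem_inter.mp h).1⟩)
            (hyB _ ⟨j, hj, fun h => hAqBy j (Finset.mem_inter.mp h).2 hj⟩)
        rw [hB'univ]
        have hR'A : R (ω ∩ Aq) ⊆ R ω := hRmono _ _ Finset.inter_subset_left
        have hR'B : R (ω ∩ Aq) ⊆ B ω := hRα (ω ∩ Aq) Finset.inter_subset_right
        have key := skew_box_bound (fR := f (R (ω ∩ Aq))) (fA := f (R ω)) (fB := f (B ω)) (fP := f Set.univ)
          (gR := g (R (ω ∩ Aq))) (gA := g (R ω)) (gB := g (B ω)) (gP := g Set.univ)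
          (hf hR'A) hRSle (hf hR'B) (hg hR'A) hRSle' (hg hR'B)
        nlinarith [key]
  /- ### the partner map: into the complement of `D`, admissible, injective -/
  have ψ_out : ∀ ω ∈ D, ψ ω ∈ Out.powerset.filter (fun ω' => ¬ (y ∉ B ω')) := by
    intro ω hω
    obtain ⟨hωO, hy⟩ := (memD ω).mp hω
    obtain ⟨j, hj⟩ := hByne
    refine Finset.mem_filter.mpr ⟨Finset.mem_powerset.mpr ?_, not_not.mpr (hyB _ ⟨j, hj, ?_⟩)⟩
    · simp only [hψ]; split_ifs
      · exact Finset.inter_subset_left.trans hωO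
      · exact hAqOut
      · exact Finset.inter_subset_left.trans hωO
    · simp only [hψ]; split_ifs
      · exact fun h => hByCq j hj (Finset.mem_inter.mp h).2
      · exact fun h => hAqBy j h hj
      · exact fun h => hAqBy j (Finset.mem_inter.mp h).2 hj
  have ψ_adm : ∀ ω ∈ D, admS (ψ ω) := by
    intro ω hω
    obtain ⟨hωO, hy⟩ := (memD ω).mp hω
    simp only [hadmS, not_and]
    intro hyR
    exfalso
    have hyR' : y ∈ R (ψ ω) := hyR
    simp only [hψ] at hyR'
    split_ifs at hyR' with h1 h2
    · exact hyU (Finset.mem_coe.mp (hRC ω hωO hyR'))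
    · exact hyA Aq subset_rfl hyR'
    · exact hyA (ω ∩ Aq) Finset.inter_subset_right hyR'
  have ψ_inj : Set.InjOn ψ ↑D := by
    intro ω₁ h₁ ω₂ h₂ heq
    have h₁' : ω₁ ∈ D := Finset.mem_coe.mp h₁
    have h₂' : ω₂ ∈ D := Finset.mem_coe.mp h₂
    obtain ⟨i₀, hi₀⟩ := hAqne
    simp only [hψ] at heq
    by_cases hA1 : Aq ⊆ ω₁ <;> by_cases hA2 : Aq ⊆ ω₂
    · rw [if_pos hA1, if_pos hA2] at heq
      rw [D_shapeA ω₁ h₁' hA1, D_shapeA ω₂ h₂' hA2, heq]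
    · rw [if_pos hA1, if_neg hA2] at heq
      exfalso
      by_cases hz : ω₂ ∩ Aq = ∅
      · rw [if_pos hz] at heq
        have : i₀ ∈ ω₁ ∩ Cq := heq ▸ hi₀
        exact hAqCq i₀ hi₀ (Finset.mem_inter.mp this).2
      · rw [if_neg hz] at heq
        obtain ⟨i, hi⟩ := Finset.nonempty_of_ne_empty hz
        have : i ∈ ω₁ ∩ Cq := heq ▸ hi
        exact hAqCq i (Finset.mem_inter.mp hi).2 (Finset.mem_inter.mp this).2
    · rw [if_neg hA1, if_pos hA2] at heq
      exfalso
      by_cases hz : ω₁ ∩ Aq = ∅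
      · rw [if_pos hz] at heq
        have : i₀ ∈ ω₂ ∩ Cq := heq ▸ hi₀
        exact hAqCq i₀ hi₀ (Finset.mem_inter.mp this).2
      · rw [if_neg hz] at heq
        obtain ⟨i, hi⟩ := Finset.nonempty_of_ne_empty hz
        have : i ∈ ω₂ ∩ Cq := heq ▸ hi
        exact hAqCq i (Finset.mem_inter.mp hi).2 (Finset.mem_inter.mp this).2
    · rw [if_neg hA1, if_neg hA2] at heq
      by_cases hz1 : ω₁ ∩ Aq = ∅ <;> by_cases hz2 : ω₂ ∩ Aq = ∅
      · rw [D_shapeB ω₁ h₁' hA1, D_shapeB ω₂ h₂' hA2, hz1, hz2]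
      · rw [if_pos hz1, if_neg hz2] at heq
        exact absurd (fun i hi => (Finset.mem_inter.mp (heq ▸ hi : i ∈ ω₂ ∩ Aq)).1) hA2
      · rw [if_neg hz1, if_pos hz2] at heq
        exact absurd (fun i hi => (Finset.mem_inter.mp (heq.symm ▸ hi : i ∈ ω₁ ∩ Aq)).1) hA1
      · rw [if_neg hz1, if_neg hz2] at heq
        rw [D_shapeB ω₁ h₁' hA1, D_shapeB ω₂ h₂' hA2, heq]
  /- ### assembling -/
  have hL : (∑ ω ∈ Out.powerset, if y ∉ B ω then TU ω else 0) = ∑ ω ∈ D, TU ω := by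
    rw [hD, Finset.sum_filter]
  have hR : (∑ ω ∈ Out.powerset, if admS ω then TS ω else 0) =
      ∑ ω ∈ D, TS ω + ∑ ω ∈ Out.powerset.filter (fun ω' => ¬ (y ∉ B ω')), (if admS ω then TS ω else 0) := by
    rw [← Finset.sum_filter_add_sum_filter_not Out.powerset (fun ω => y ∉ B ω)]
    congr 1
    refine Finset.sum_congr rfl fun ω hω => ?_
    obtain ⟨_, hy⟩ := (memD ω).mp hω
    have hadm : admS ω := by simp only [hadmS, not_and]; exact fun _ h => hy h
    rw [if_pos hadm]
  have hpartners : ∑ ω ∈ D, TS (ψ ω) ≤ ∑ ω ∈ Out.powerset.filter (fun ω' => ¬ (y ∉ B ω')), (if admS ω then TS ω else 0) := by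
    have himg : ∑ ω ∈ D, TS (ψ ω) = ∑ ω' ∈ D.image ψ, (if admS ω' then TS ω' else 0) := by
      rw [Finset.sum_image ψ_inj]
      refine Finset.sum_congr rfl fun ω hω => ?_
      rw [if_pos (ψ_adm ω hω)]
    rw [himg]
    refine Finset.sum_le_sum_of_subset_of_nonneg ?_ ?_
    · intro ω' hω'
      obtain ⟨ω, hω, rfl⟩ := Finset.mem_image.mp hω'
      exact ψ_out ω hω
    · intro ω hω _
      obtain ⟨hω1, hω2⟩ := Finset.mem_filter.mp hω
      exact rest_nonneg ω hω1 hω2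
  have hbound : ∑ ω ∈ D, TU ω ≤ ∑ ω ∈ D, TS ω + ∑ ω ∈ D, TS (ψ ω) := by
    have h := Finset.sum_le_sum termwise
    rw [Finset.sum_add_distrib, Finset.sum_add_distrib, sum_tr, add_zero] at h
    exact h
  rw [hL, hR]
  linarith

end Coefficientwise

end Summit.CriticalPhenomena.PercolationContinuityZ3.Theorems
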